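import Mathlib
import Literature.NumberTheory.Automorphic.ReciprocityGLn
import Literature.NumberTheory.Automorphic.BaseChangeInductionAlong
import Literature.NumberTheory.Automorphic.PairLFunctionBaseChange

/-!
# `TwistCtrl` bookkeeping for the crux `QuadraticWindow.HostInducedRep` (stmt-Langlands-10902)

Stub `stub_signedTwist` of the line `grs-explicit-descent` asks, at a place `u` of the CM field `K`
above a guarded place `v` of `F₀`, for `(arithFrobPolyOfSatake ι q_u (2n) β).scaleRoots t =
hostPoly ι n α c v` (`f(u∣v) = 1`) resp. `= sqPoly (hostPoly ι n α c v)` (`f(u∣v) = 2`); `β`, `t` are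
the Satake parameter of the signed twist `τ' = BC_K(Π) ⊗ ψ₀'` at `u` and the Frobenius value of the
untwisting `ℓ`-adic character.  Proved here for every `n` as pure algebra from the relation
`satakePolynomial B = inducedSatakePolynomial v (α · c)` of `IsInducedPackage`, the shapes
`β = B · s` (`f = 1`), `β = B² · s` (`f = 2`) and `ι t = q_u^{n/2} s`
(`twistCtrl_scaleRoots_of_inertiaDeg_eq_one/_two`); on the way `hostPoly ι n α c v =
arithFrobPolyOfSatake ι q_v n B` (registered helper stub `stub_hostPolyIdentity`); `hostPoly`, `sqPoly` are copied by value from the registered skeleton.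
-/

open scoped BigOperators Polynomial Classical
open Polynomial IsDedekindDomain NumberField Literature.NumberTheory.Automorphic

set_option linter.dupNamespace false

noncomputable section

namespace Summit.Langlands.Langlands.Theorems.HostInducedRep.GrsExplicitDescent

section Defs

variable {F₀ F : Type} [Field F₀] [NumberField F₀] [Field F] [NumberField F] [Algebra F₀ F]

/-- **The host polynomial at `v`** (verbatim copy of the skeleton's `hostPoly` = the finprod in the
conclusion of the crux): `∏_{w ∣ v} P_w(X^{f(w∣v)})`, `P_w = arithFrobPolyOfSatake ι q_w n (α_w · c_w)`. -/
def hostPoly {ℓ : ℕ} [Fact ℓ.Prime] (ι : PadicAlgCl ℓ ≃+* ℂ) (n : ℕ)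
    (α : HeightOneSpectrum (𝓞 F) → Multiset ℂ) (c : HeightOneSpectrum (𝓞 F) → ℂ)
    (v : HeightOneSpectrum (𝓞 F₀)) : (PadicAlgCl ℓ)[X] :=
  ∏ᶠ w ∈ {w : HeightOneSpectrum (𝓞 F) | w.under (𝓞 F₀) = v},
    Polynomial.expand (PadicAlgCl ℓ) (w.asIdeal.inertiaDeg (𝓞 F₀))
      (arithFrobPolyOfSatake ι w.residueCard n ((α w).map (fun a ↦ a * c w)))

end Defs

/-- **The squares polynomial** `∏_{a ∈ roots P} (X - a²)` (verbatim copy of the skeleton's `sqPoly`). -/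
def sqPoly {R : Type*} [CommRing R] [IsDomain R] (P : R[X]) : R[X] :=
  (P.roots.map fun a ↦ X - C (a ^ 2)).prod

section Algebra

open Multiset

variable {L : Type*} [Field L]

/-- `scaleRoots` of a product of linear factors scales the roots. -/
theorem multiset_prod_X_sub_C_scaleRoots {α : Type*} (m : Multiset α) (g : α → L) (t : L) :
    ((m.map fun b ↦ X - C (g b)).prod).scaleRoots t = (m.map fun b ↦ X - C (t * g b)).prod := by
  induction m using Multiset.induction_on with
  | empty => simp
  | cons b m ih =>
    rw [Multiset.map_cons, Multiset.prod_cons, Multiset.map_cons, Multiset.prod_cons,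
      mul_scaleRoots_of_noZeroDivisors, ih, X_sub_C_scaleRoots, mul_comm (g b) t]

variable [IsAlgClosed L]

/-- In an algebraically closed field, `X^f - a = ∏_{r^f = a} (X - r)`. -/
theorem prod_nthRoots_X_sub_C (f : ℕ) (hf : 0 < f) (a : L) :
    ((Polynomial.nthRoots f a).map fun r ↦ X - C r).prod = X ^ f - C a := by
  have hmon : (X ^ f - C a : L[X]).Monic := monic_X_pow_sub_C a hf.ne'
  have hcard : Multiset.card (X ^ f - C a : L[X]).roots = (X ^ f - C a : L[X]).natDegree :=
    IsAlgClosed.card_roots_eq_natDegree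
  exact prod_multiset_X_sub_C_of_monic_of_roots_card_eq hmon hcard

/-- `card (nthRoots f a) = f` in an algebraically closed field (`f ≥ 1`). -/
theorem card_nthRoots_eq (f : ℕ) (a : L) :
    Multiset.card (Polynomial.nthRoots f a) = f := by
  have h : Multiset.card (X ^ f - C a : L[X]).roots = (X ^ f - C a : L[X]).natDegree :=
    IsAlgClosed.card_roots_eq_natDegree
  rwa [natDegree_X_pow_sub_C] at h

variable [CharZero L]

/-- **Inverting and rescaling `f`-th roots**: for `κ ≠ 0`, `{(κ r)⁻¹ : r^f = a} = {x : x^f = (κ^f a)⁻¹}`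
as multisets (algebraically closed field of characteristic zero). -/
theorem nthRoots_map_inv_mul {κ : L} (hκ : κ ≠ 0) (f : ℕ) (hf : 0 < f) (a : L) :
    (Polynomial.nthRoots f a).map (fun r ↦ (κ * r)⁻¹) = Polynomial.nthRoots f (κ ^ f * a)⁻¹ := by
  by_cases ha : a = 0
  · subst ha
    simp only [mul_zero, inv_zero, nthRoots_zero_right, Multiset.map_replicate]
  have hfL : (f : L) ≠ 0 := Nat.cast_ne_zero.mpr hf.ne'
  have hκa : (κ ^ f * a)⁻¹ ≠ 0 := inv_ne_zero (mul_ne_zero (pow_ne_zero _ hκ) ha)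
  -- both sides are nodup of cardinality `f`, and the left is contained in the right
  have hnodupR : (Polynomial.nthRoots f (κ ^ f * a)⁻¹).Nodup :=
    nodup_roots (separable_X_pow_sub_C _ hfL hκa)
  have hinj : Function.Injective (fun r : L ↦ (κ * r)⁻¹) := fun x y hxy ↦ by
    have := inv_injective hxy
    exact mul_left_cancel₀ hκ this
  have hnodupL : ((Polynomial.nthRoots f a).map (fun r ↦ (κ * r)⁻¹)).Nodup :=
    (nodup_roots (separable_X_pow_sub_C _ hfL ha)).map hinj
  symm
  apply Multiset.eq_of_le_of_card_le
  · rw [Multiset.le_iff_subset hnodupR]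
    intro x hx
    rw [Polynomial.mem_nthRoots hf] at hx
    rw [Multiset.mem_map]
    -- `x ≠ 0`, and `r := (κ x)⁻¹` is an `f`-th root of `a`
    have hx0 : x ≠ 0 := by rintro rfl; rw [zero_pow hf.ne'] at hx; exact hκa hx.symm
    refine ⟨(κ * x)⁻¹, ?_, ?_⟩
    · rw [Polynomial.mem_nthRoots hf, inv_pow, mul_pow, hx]
      field_simp
    · field_simp
  · rw [Multiset.card_map, card_nthRoots_eq, card_nthRoots_eq]

/-- **Core identity.**  If a multiset `B` is the multiset of `f_w`-th roots of the entries of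
multisets `A_w` — `∏_{b ∈ B} (X - b) = ∏_w ∏_{a ∈ A_w} (X^{f_w} - a)` — then for `κ ≠ 0`,
`∏_{b ∈ B} (X - (κ b)⁻¹) = ∏_w ∏_{a ∈ A_w} (X^{f_w} - (κ^{f_w} a)⁻¹)`. -/
theorem prod_X_sub_C_inv_mul_of_prod_eq {W : Type*} (s : Finset W) (f : W → ℕ) (hf : ∀ w ∈ s, 0 < f w)
    (A : W → Multiset L) (B : Multiset L) {κ : L} (hκ : κ ≠ 0)
    (h : (B.map fun b ↦ X - C b).prod = ∏ w ∈ s, ((A w).map fun a ↦ X ^ f w - C a).prod) :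
    (B.map fun b ↦ X - C (κ * b)⁻¹).prod =
      ∏ w ∈ s, ((A w).map fun a ↦ X ^ f w - C (κ ^ f w * a)⁻¹).prod := by
  -- Step 1: `B = ∑_w ∑_{a ∈ A_w} nthRoots (f w) a`, by taking roots in `h`.
  have hB : B = s.val.bind fun w ↦ (A w).bind fun a ↦ Polynomial.nthRoots (f w) a := by
    have hl := congrArg Polynomial.roots h
    rw [roots_multiset_prod_X_sub_C] at hl
    rw [hl, roots_prod]
    · refine Multiset.bind_congr fun w hw ↦ ?_
      rw [roots_multiset_prod]
      · rw [Multiset.bind_map]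
        rfl
      · rw [Multiset.mem_map]
        rintro ⟨a, -, ha⟩
        exact (monic_X_pow_sub_C a (hf w hw).ne').ne_zero ha
    · rw [Finset.prod_ne_zero_iff]
      intro w hw
      exact (monic_multiset_prod_of_monic _ _ fun a _ ↦ monic_X_pow_sub_C a (hf w hw).ne').ne_zero
  -- Step 2: push the map through and use the root identities factor by factor.
  rw [hB, Multiset.map_bind, Multiset.prod_bind, Finset.prod_eq_multiset_prod]
  refine congrArg Multiset.prod (Multiset.map_congr rfl fun w hw ↦ ?_)
  have hfw : 0 < f w := hf w hw
  rw [Multiset.map_bind, Multiset.prod_bind]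
  refine congrArg Multiset.prod (Multiset.map_congr rfl fun a _ ↦ ?_)
  show ((Polynomial.nthRoots (f w) a).map fun b ↦ X - C (κ * b)⁻¹).prod =
    X ^ f w - C (κ ^ f w * a)⁻¹
  rw [← prod_nthRoots_X_sub_C (f w) hfw, ← nthRoots_map_inv_mul hκ (f w) hfw a, Multiset.map_map]
  rfl

end Algebra
section Applied

variable {ℓ : ℕ} [Fact ℓ.Prime]

/-- `scaleRoots` of the Goldring–Koskivirta polynomial multiplies its roots:
`(∏_{b ∈ β} (X - ι⁻¹((q^{(m-1)/2} b)⁻¹))).scaleRoots t = ∏_{b ∈ β} (X - t ι⁻¹((q^{(m-1)/2} b)⁻¹))`. -/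
theorem arithFrobPolyOfSatake_scaleRoots (ι : PadicAlgCl ℓ ≃+* ℂ) (q m : ℕ) (β : Multiset ℂ)
    (t : PadicAlgCl ℓ) :
    (arithFrobPolyOfSatake ι q m β).scaleRoots t =
      (β.map fun b ↦ X - C (t * ι.symm (((Real.sqrt q : ℝ) : ℂ) ^ (m - 1) * b)⁻¹)).prod := by
  unfold arithFrobPolyOfSatake
  exact multiset_prod_X_sub_C_scaleRoots β _ t

/-- `√q ≠ 0` in `ℂ` for `q ≥ 1`. -/
theorem sqrt_cast_ne_zero {q : ℕ} (hq : 0 < q) : (((Real.sqrt q : ℝ) : ℂ)) ≠ 0 := by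
  have : (0 : ℝ) < Real.sqrt q := Real.sqrt_pos.mpr (by exact_mod_cast hq)
  exact_mod_cast this.ne'

/-- `(√q)² = q` in `ℂ`. -/
theorem sqrt_cast_sq (q : ℕ) : (((Real.sqrt q : ℝ) : ℂ)) ^ 2 = (q : ℂ) := by
  rw [← Complex.ofReal_pow, Real.sq_sqrt (Nat.cast_nonneg q), Complex.ofReal_natCast]

/-- `√(q^f) = (√q)^f`. -/
theorem sqrt_cast_pow (q f : ℕ) :
    ((Real.sqrt ((q ^ f : ℕ) : ℝ) : ℝ) : ℂ) = (((Real.sqrt q : ℝ) : ℂ)) ^ f := by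
  rw [← Complex.ofReal_pow]
  congr 1
  rw [Nat.cast_pow, Real.sqrt_eq_iff_eq_sq (pow_nonneg (Nat.cast_nonneg q) f)
    (pow_nonneg (Real.sqrt_nonneg _) f), ← pow_mul, mul_comm, pow_mul,
    Real.sq_sqrt (Nat.cast_nonneg q)]

/-- **Untwisting at a place of residue degree one** (`f(u∣v) = 1`, `q_u = q_v = q`): if the Satake
parameter of `τ'` at `u` is `β = B · s` (`B` the parameter of the induced package at `v`,
`s = ψ₀'(ϖ_u) ≠ 0`) and `t = ι⁻¹(q^{n/2} s)` (the Frobenius value of the `ℓ`-adic avatar of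
`ψ₀' ‖·‖^{-n/2}`, in the tree's convention applied to `(ψ₀')⁻¹‖·‖^{n/2}`), then the rank-`2n`
Goldring–Koskivirta polynomial of `β`, with roots scaled by `t`, is the rank-`n` polynomial of `B`:
`(√q)^{2n-1} / ((√q)^{n} ·) = (√q)^{n-1}`. -/
theorem scaleRoots_arithFrobPolyOfSatake_twist (ι : PadicAlgCl ℓ ≃+* ℂ) {q : ℕ} (hq : 0 < q)
    (n : ℕ) (B : Multiset ℂ) {s : ℂ} (hs : s ≠ 0) :
    (arithFrobPolyOfSatake ι q (2 * n) (B.map (· * s))).scaleRoots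
        (ι.symm ((((Real.sqrt q : ℝ) : ℂ)) ^ n * s)) =
      arithFrobPolyOfSatake ι q n B := by
  rw [arithFrobPolyOfSatake_scaleRoots, Multiset.map_map]
  unfold arithFrobPolyOfSatake
  refine congrArg Multiset.prod (Multiset.map_congr rfl fun b _ ↦ ?_)
  simp only [Function.comp_apply]
  rw [← map_mul]
  refine congrArg (fun x ↦ X - C (ι.symm x)) ?_
  have hr := sqrt_cast_ne_zero hq
  have h2 : 2 * n - 1 = n + (n - 1) := by omega
  rw [h2, pow_add]
  by_cases hb : b = 0
  · subst hb; simp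
  · field_simp

/-- **Untwisting at a place of residue degree two** (`f(u∣v) = 2`, `q_u = q_v² = q²`): if the
Satake parameter of `τ'` at `u` is `β = B² · s` (`Sat(BC(Π), u) = Sat(Π, v)²`) and
`t = ι⁻¹(q^{n} s) = ι⁻¹(q_u^{n/2} ψ₀'(ϖ_u))`, then the rank-`2n` polynomial of `β` at `q_u`, with
roots scaled by `t`, is the squares polynomial of the rank-`n` polynomial of `B` at `q_v`. -/
theorem scaleRoots_arithFrobPolyOfSatake_twist_sq (ι : PadicAlgCl ℓ ≃+* ℂ) {q : ℕ} (hq : 0 < q)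
    (n : ℕ) (B : Multiset ℂ) {s : ℂ} (hs : s ≠ 0) :
    (arithFrobPolyOfSatake ι (q ^ 2) (2 * n) (B.map fun b ↦ b ^ 2 * s)).scaleRoots
        (ι.symm ((q : ℂ) ^ n * s)) =
      sqPoly (arithFrobPolyOfSatake ι q n B) := by
  rw [arithFrobPolyOfSatake_scaleRoots, Multiset.map_map, sqPoly, roots_arithFrobPolyOfSatake,
    Multiset.map_map]
  refine congrArg Multiset.prod (Multiset.map_congr rfl fun b _ ↦ ?_)
  simp only [Function.comp_apply]
  rw [← map_mul, ← map_pow]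
  refine congrArg (fun x ↦ X - C (ι.symm x)) ?_
  rw [sqrt_cast_pow q 2, inv_pow, mul_pow, ← pow_mul, ← pow_mul]
  have hqC : (q : ℂ) ≠ 0 := by exact_mod_cast hq.ne'
  have hsq := sqrt_cast_sq q
  -- rewrite every power of `√q` as a power of `q` through `(√q)² = q`
  have h1 : (((Real.sqrt q : ℝ) : ℂ)) ^ (2 * (2 * n - 1)) = (q : ℂ) ^ (2 * n - 1) := by
    rw [pow_mul, hsq]
  have h3 : (((Real.sqrt q : ℝ) : ℂ)) ^ ((n - 1) * 2) = (q : ℂ) ^ (n - 1) := by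
    rw [mul_comm, pow_mul, hsq]
  rw [h1, h3]
  have h2 : 2 * n - 1 = n + (n - 1) := by omega
  rw [h2, pow_add]
  by_cases hb : b = 0
  · subst hb; simp
  · field_simp

end Applied
section Host

variable {F₀ F : Type} [Field F₀] [NumberField F₀] [Field F] [NumberField F] [Algebra F₀ F]
  {ℓ : ℕ} [Fact ℓ.Prime]

/-- The fibre of a place `v` of `F₀` in `F` is finite. -/
theorem finite_fibre (v : HeightOneSpectrum (𝓞 F₀)) :
    {w : HeightOneSpectrum (𝓞 F) | w.under (𝓞 F₀) = v}.Finite := by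
  -- adapted from Cruxes/HostInducedRep/Disproof.lean §3 `finite_fibre`
  have hfin := IsDedekindDomain.primesOver_finite v.asIdeal (𝓞 F)
  refine (hfin.preimage (f := fun w : HeightOneSpectrum (𝓞 F) ↦ w.asIdeal)
    (fun w _ w' _ h ↦ HeightOneSpectrum.ext h)).subset fun w hw ↦ ?_
  refine ⟨w.isPrime, ⟨?_⟩⟩
  rw [Set.mem_setOf_eq] at hw
  rw [← hw, HeightOneSpectrum.under_asIdeal]

omit [NumberField F₀] [NumberField F] in
/-- The two spellings of the fibre (`Ideal.under` of `asIdeal`, resp. `HeightOneSpectrum.under`)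
agree. -/
theorem setOf_asIdeal_under_eq (v : HeightOneSpectrum (𝓞 F₀)) :
    {w : HeightOneSpectrum (𝓞 F) | w.asIdeal.under (𝓞 F₀) = v.asIdeal} =
      {w : HeightOneSpectrum (𝓞 F) | w.under (𝓞 F₀) = v} := by
  ext w
  simp only [Set.mem_setOf_eq, HeightOneSpectrum.ext_iff, HeightOneSpectrum.under_asIdeal]

/-- One factor of the host polynomial, expanded: `P_w(X^f)` for `q_w = q^f`, written as a product of
`X^f - (κ^f a')⁻¹` over the transported parameter (`κ = ι⁻¹((√q)^{n-1})`). -/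
theorem expand_arithFrobPolyOfSatake_pow (ι : PadicAlgCl ℓ ≃+* ℂ) (q f n : ℕ) (A' : Multiset ℂ) :
    Polynomial.expand (PadicAlgCl ℓ) f (arithFrobPolyOfSatake ι (q ^ f) n A') =
      ((A'.map ι.symm).map fun a ↦
        X ^ f - C (ι.symm ((((Real.sqrt (q : ℝ) : ℝ) : ℂ)) ^ (n - 1)) ^ f * a)⁻¹).prod := by
  unfold arithFrobPolyOfSatake
  rw [map_multiset_prod, Multiset.map_map, Multiset.map_map]
  refine congrArg Multiset.prod (Multiset.map_congr rfl fun a _ ↦ ?_)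
  simp only [Function.comp_apply, map_sub, Polynomial.expand_X, Polynomial.expand_C]
  have key : ι.symm ((((Real.sqrt ((q ^ f : ℕ) : ℝ) : ℝ) : ℂ)) ^ (n - 1) * a)⁻¹ =
      (ι.symm ((((Real.sqrt (q : ℝ) : ℝ) : ℂ)) ^ (n - 1)) ^ f * ι.symm a)⁻¹ := by
    rw [sqrt_cast_pow, ← map_pow, ← map_mul, ← map_inv₀, ← pow_mul, ← pow_mul,
      Nat.mul_comm f (n - 1)]
  rw [key]

/-- **The host polynomial is the rank-`n`-normalised Frobenius polynomial of the induced Satake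
parameter.**  If `B` is the induced Satake parameter at `v` of the twisted family `α_w c_w`
(`∏_{b ∈ B} (X - b) = ∏_{w ∣ v} ∏_{a ∈ α_w c_w} (X^{f(w∣v)} - a)`, the relation of
`IsInducedPackage`), then `∏_{w ∣ v} P_w(X^{f(w∣v)}) = ∏_{b ∈ B} (X - ι⁻¹((q_v^{(n-1)/2} b)⁻¹))`
(`hostPoly … v = arithFrobPolyOfSatake ι q_v n B`): the `f(w∣v)`-th roots of
`(q_w^{(n-1)/2} a)⁻¹`, `q_w = q_v^{f(w∣v)}`, are the `(q_v^{(n-1)/2} b)⁻¹`, `b^{f} = a`. -/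
theorem hostPoly_eq_arithFrobPolyOfSatake (ι : PadicAlgCl ℓ ≃+* ℂ) (n : ℕ)
    (α : HeightOneSpectrum (𝓞 F) → Multiset ℂ) (c : HeightOneSpectrum (𝓞 F) → ℂ)
    (v : HeightOneSpectrum (𝓞 F₀)) (B : Multiset ℂ)
    (hB : satakePolynomial B = inducedSatakePolynomial v (fun w ↦ (α w).map (fun a ↦ a * c w))) :
    hostPoly ι n α c v = arithFrobPolyOfSatake ι v.residueCard n B := by
  classical
  -- opaque names for the twisted family `A_w = α_w c_w` and the residue degrees `f w = f(w∣v)`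
  obtain ⟨A, hA⟩ : ∃ A : HeightOneSpectrum (𝓞 F) → Multiset ℂ,
      A = fun w ↦ (α w).map (fun a ↦ a * c w) := ⟨_, rfl⟩
  obtain ⟨f, hf⟩ : ∃ f : HeightOneSpectrum (𝓞 F) → ℕ,
      f = fun w ↦ w.asIdeal.inertiaDeg (𝓞 F₀) := ⟨_, rfl⟩
  rw [← hA] at hB
  have hfpos : ∀ w ∈ (finite_fibre (F := F) v).toFinset, 0 < f w := fun w _ ↦ by
    rw [hf]; exact Ideal.inertiaDeg_pos _ _
  -- (1) the hypothesis as a finite product over the fibre, in `ℂ[X]`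
  have h1 : (B.map fun b ↦ X - C b).prod =
      ∏ w ∈ (finite_fibre (F := F) v).toFinset, ((A w).map fun a ↦ X ^ f w - C a).prod := by
    have h := hB
    rw [satakePolynomial, inducedSatakePolynomial, setOf_asIdeal_under_eq,
      finprod_mem_eq_finite_toFinset_prod _ (finite_fibre v)] at h
    rw [h, hf]
    exact Finset.prod_congr rfl fun w _ ↦ satakePolynomial_comp_X_pow (A w) _
  -- (2) transport to `ℚ̄_ℓ[X]` along `ι⁻¹`
  have h2 : ((B.map ι.symm).map fun b ↦ X - C b).prod =
      ∏ w ∈ (finite_fibre (F := F) v).toFinset,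
        (((A w).map ι.symm).map fun a ↦ X ^ f w - C a).prod := by
    have h := congrArg (Polynomial.map (ι.symm : ℂ →+* PadicAlgCl ℓ)) h1
    rw [Polynomial.map_multiset_prod, Multiset.map_map, Polynomial.map_prod] at h
    have hL : ((B.map ι.symm).map fun b ↦ X - C b) =
        B.map (Polynomial.map (ι.symm : ℂ →+* PadicAlgCl ℓ) ∘ fun b ↦ X - C b) := by
      rw [Multiset.map_map]
      refine Multiset.map_congr rfl fun b _ ↦ ?_
      simp
    have hRw : ∀ w, (((A w).map ι.symm).map fun a ↦ X ^ f w - C a).prod =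
        Polynomial.map (ι.symm : ℂ →+* PadicAlgCl ℓ) (((A w).map fun a ↦ X ^ f w - C a).prod) := by
      intro w
      rw [Polynomial.map_multiset_prod, Multiset.map_map, Multiset.map_map]
      refine congrArg Multiset.prod (Multiset.map_congr rfl fun a _ ↦ ?_)
      simp
    rw [hL, h]
    exact Finset.prod_congr rfl fun w _ ↦ (hRw w).symm
  -- (3) the core identity with `κ = ι⁻¹((√q_v)^{n-1})`
  have hr0 : (((Real.sqrt (v.residueCard : ℝ) : ℝ) : ℂ)) ≠ 0 :=
    sqrt_cast_ne_zero (zero_lt_one.trans v.one_lt_residueCard)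
  have hκ : ι.symm ((((Real.sqrt (v.residueCard : ℝ) : ℝ) : ℂ)) ^ (n - 1)) ≠ 0 :=
    (map_ne_zero ι.symm).mpr (pow_ne_zero _ hr0)
  have h3 := prod_X_sub_C_inv_mul_of_prod_eq _ f hfpos (fun w ↦ (A w).map ι.symm) (B.map ι.symm)
    hκ h2
  -- (4) identify the right-hand side …
  have hR : arithFrobPolyOfSatake ι v.residueCard n B = ((B.map ι.symm).map fun b ↦
      X - C (ι.symm ((((Real.sqrt (v.residueCard : ℝ) : ℝ) : ℂ)) ^ (n - 1)) * b)⁻¹).prod := by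
    unfold arithFrobPolyOfSatake
    rw [Multiset.map_map]
    refine congrArg Multiset.prod (Multiset.map_congr rfl fun b _ ↦ ?_)
    simp only [Function.comp_apply, ← map_mul, map_inv₀]
  -- … and the left-hand side, factor by factor
  rw [hR, h3, hostPoly, finprod_mem_eq_finite_toFinset_prod _ (finite_fibre v)]
  refine Finset.prod_congr rfl fun w hw ↦ ?_
  have hwv : w.under (𝓞 F₀) = v := by
    have := (finite_fibre (F := F) v).mem_toFinset.mp hw
    simpa using this
  have hfw : w.asIdeal.inertiaDeg (𝓞 F₀) = f w := by rw [hf]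
  have hAw : (α w).map (fun a ↦ a * c w) = A w := by rw [hA]
  have hq : w.residueCard = v.residueCard ^ f w := by
    rw [← hfw, ← hwv]; exact residueCard_eq_pow_inertiaDeg (F := F₀) w
  rw [hAw, hfw, hq]
  exact expand_arithFrobPolyOfSatake_pow ι _ _ _ _

end Host
section TwistCtrlIdentities

variable {F₀ F : Type} [Field F₀] [NumberField F₀] [Field F] [NumberField F] [Algebra F₀ F]
variable {K : Type} [Field K] [NumberField K] [Algebra F₀ K]
variable {ℓ : ℕ} [Fact ℓ.Prime]

/-- **The `f(u∣v) = 1` clause of `TwistCtrl`, as an identity.**  Let `u` be a place of `K` of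
residue degree `1` over the place `v` of `F₀`, `B` the induced Satake parameter at `v` of the
twisted family `(α_w c_w)_w` (relation of `IsInducedPackage`), `β = B · s` with `s ≠ 0` (on paper
`β = Sat(BC_K(Π) ⊗ ψ₀', u)`, `s = ψ₀'(ϖ_u)`, strong base change at the split place) and
`t = ι⁻¹(q_v^{n/2} s)`.  Then `(arithFrobPolyOfSatake ι q_u (2n) β).scaleRoots t = hostPoly ι n α c v`. -/
theorem twistCtrl_scaleRoots_of_inertiaDeg_eq_one (ι : PadicAlgCl ℓ ≃+* ℂ) (n : ℕ)
    (α : HeightOneSpectrum (𝓞 F) → Multiset ℂ) (c : HeightOneSpectrum (𝓞 F) → ℂ)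
    {v : HeightOneSpectrum (𝓞 F₀)} {B : Multiset ℂ}
    (hB : satakePolynomial B = inducedSatakePolynomial v (fun w ↦ (α w).map (fun a ↦ a * c w)))
    {u : HeightOneSpectrum (𝓞 K)} (huv : u.under (𝓞 F₀) = v) (hf : u.asIdeal.inertiaDeg (𝓞 F₀) = 1)
    {s : ℂ} (hs : s ≠ 0) :
    (arithFrobPolyOfSatake ι u.residueCard (2 * n) (B.map (· * s))).scaleRoots
        (ι.symm ((((Real.sqrt (v.residueCard : ℝ) : ℝ) : ℂ)) ^ n * s)) = hostPoly ι n α c v := by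
  have hq : u.residueCard = v.residueCard := by
    rw [residueCard_eq_pow_inertiaDeg (F := F₀) u, huv, hf, pow_one]
  rw [hq, scaleRoots_arithFrobPolyOfSatake_twist ι (zero_lt_one.trans v.one_lt_residueCard) n B hs,
    hostPoly_eq_arithFrobPolyOfSatake ι n α c v B hB]

/-- **The `f(u∣v) = 2` clause of `TwistCtrl`, as an identity.**  Same data with `u` of residue
degree `2` over `v` (so `q_u = q_v²`), `β = B² · s` (`Sat(BC_K(Π), u) = Sat(Π, v)²` at an inert place)
and `t = ι⁻¹(q_v^{n} s) = ι⁻¹(q_u^{n/2} ψ₀'(ϖ_u))`.  Then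
`(arithFrobPolyOfSatake ι q_u (2n) β).scaleRoots t = sqPoly (hostPoly ι n α c v)`. -/
theorem twistCtrl_scaleRoots_of_inertiaDeg_eq_two (ι : PadicAlgCl ℓ ≃+* ℂ) (n : ℕ)
    (α : HeightOneSpectrum (𝓞 F) → Multiset ℂ) (c : HeightOneSpectrum (𝓞 F) → ℂ)
    {v : HeightOneSpectrum (𝓞 F₀)} {B : Multiset ℂ}
    (hB : satakePolynomial B = inducedSatakePolynomial v (fun w ↦ (α w).map (fun a ↦ a * c w)))
    {u : HeightOneSpectrum (𝓞 K)} (huv : u.under (𝓞 F₀) = v) (hf : u.asIdeal.inertiaDeg (𝓞 F₀) = 2)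
    {s : ℂ} (hs : s ≠ 0) :
    (arithFrobPolyOfSatake ι u.residueCard (2 * n) (B.map fun b ↦ b ^ 2 * s)).scaleRoots
        (ι.symm ((v.residueCard : ℂ) ^ n * s)) = sqPoly (hostPoly ι n α c v) := by
  have hq : u.residueCard = v.residueCard ^ 2 := by
    rw [residueCard_eq_pow_inertiaDeg (F := F₀) u, huv, hf]
  rw [hq, scaleRoots_arithFrobPolyOfSatake_twist_sq ι (zero_lt_one.trans v.one_lt_residueCard) n B
    hs, hostPoly_eq_arithFrobPolyOfSatake ι n α c v B hB]

end TwistCtrlIdentities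

/-- Registered helper stub of the crux item (closed form of `hostPoly_eq_arithFrobPolyOfSatake`). -/
theorem stub_hostPolyIdentity : ∀ {F₀ F : Type} [Field F₀] [NumberField F₀] [Field F] [NumberField F] [Algebra F₀ F] {ℓ : ℕ} [Fact ℓ.Prime] (ι : PadicAlgCl ℓ ≃+* ℂ) (n : ℕ) (α : HeightOneSpectrum (𝓞 F) → Multiset ℂ) (c : HeightOneSpectrum (𝓞 F) → ℂ) (v : HeightOneSpectrum (𝓞 F₀)) (B : Multiset ℂ), satakePolynomial B = inducedSatakePolynomial v (fun w ↦ (α w).map (fun a ↦ a * c w)) → hostPoly ι n α c v = arithFrobPolyOfSatake ι v.residueCard n B :=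
  fun ι n α c v B h ↦ hostPoly_eq_arithFrobPolyOfSatake ι n α c v B h

end Summit.Langlands.Langlands.Theorems.HostInducedRep.GrsExplicitDescent

end
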